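/-
Copyright: public-domain mathematics; formalisation produced inside the b2b autopsy cell `lwe-quantum-autopsy`
(Part 1, generation 17).  Source analysed: Yilei Chen, "Quantum Algorithms for Lattice Problems",
IACR ePrint 2024/555, version of 2024-04-18 (WITHDRAWN by the author: "Step 9 of the algorithm contains a
bug, which I don't know how to fix").  Bib key `ChenQuantumLattice2024`.
REPRODUCTION / ANALYSIS OF A CLAIMED RESULT UNDER ADJUDICATION (withdrawn).  HONEST FRAMING: a theorem of
finite-dimensional linear algebra written for the measurement step of a withdrawn algorithm; it repairs
nothing, breaks nothing, and is not progress on any lattice problem or on the summit `QuantumAdvantage`.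
-/
import Literature.Computability.Cryptography.ChenQuantumLWEThresholdAllPrimes

/-!
# Box frames: the coarse step of the composite tolerance analysis of Chen's Step 8

State of the Step-8 tolerance constant after (AD) `ChenQuantumLWEThresholdAllPrimes` and (AE)
`ChenQuantumLWEThresholdCompositeFailure`: for an admissible PRIME modulus `Q` the threshold below which
an almost-sure general measurement cannot separate Chen's state `S = |φ₇''⟩` from its divisor-orbit partner
is EXACTLY `1/(Q² + 1)`; for composite `Q` it lies in the window `[1/(32·𝔭(Q)²), 1/(𝔭(Q)² + 1)]`
(`𝔭(Q)` the largest prime factor), and the natural conjecture is the upper end.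

This module proves the ABSTRACT ENGINE of the induction step `Q/p → Q` of that conjecture — nothing more.
By the strong induction over the divisors of `Q` sketched in the cell's handoff, the `(Q/p)`-torsion
sub-blocks of the slope block are copies of the block of modulus `Q/p`, so (inductively) the measurement's
almost-certain outcome is constant on BOXES of `D = (Q/p)²` rays; what is then left is a configuration of
`p` MUTUALLY UNBIASED BOX FRAMES: `p` families, each an orthogonal frame of `p²·D` vectors of norm² `a`
grouped into `p²` boxes of `D`, every vector of one family carrying mass exactly `a²/p²` on every box of
every other family (`MUBBoxFrames p a z` below; for `D = 1` these are (AC)'s `MUBFrames p a z`, see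
`MUBFrames.toBoxFrames`).  THE THEOREM (`MUBBoxFrames.sameOutcome₃`): if a general measurement is
`ε`-almost sure on every vector, its almost-certain outcome is constant on each box, `p ≥ 3` and
`ε·(p² + 1) < 1`, then the outcome is the same on ALL vectors of all families.  The proof is the
Hilbert–Schmidt Cauchy–Schwarz argument of (AD) run with boxes in place of vectors: the box multiplicity `D`
CANCELS and one lands on literally the same inequality `MUBFrames.key_ineq`/`key_contra` with `q = p`
(`MUBBoxFrames.key_ineq`), so the cost of the coarse step is `ε(p² + 1) < 1` — independent of `D`, which is
what makes the conjectured composite constant `1/(𝔭(Q)² + 1)` (the maximum over the prime factors) come out.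

What this module does NOT do: it does not carry out the recursion (the identification of the torsion
sub-blocks with blocks of smaller modulus, and the final instantiation for `Shape`), so it has, as yet, NO
consequence for Step 8 beyond (AD)/(AE); the composite constant stays OPEN.  The present file is recorded so
that the remaining work is bookkeeping over `ZMod Q`, not analysis.

References: [cite: ChenQuantumLattice2024, §3.5.8 pp. 33–34, eq. (35) p. 31]; [cite: NielsenChuang2010,
§2.2.6 p. 90 (POVM formalism), Box 2.3 p. 87 (completeness relation, Cauchy–Schwarz)].
-/

open scoped BigOperators ComplexOrder MatrixOrder
open Matrix Finset

namespace Literature.Computability.Cryptography.Chen2024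

section BOX

variable {X : Type*} [Fintype X] [DecidableEq X]
variable {I B Δ : Type*} [Fintype I] [Fintype B] [DecidableEq B] [Fintype Δ] [DecidableEq Δ]

omit [DecidableEq Δ] in
/-- A sum over the index set `{(s, (b, d)) : b ∈ W_s}` is a triple sum. [folklore] -/
theorem sum_highBox_eq {M : Type*} [AddCommMonoid M] (W : I → Finset B) (f : I × (B × Δ) → M) :
    ∑ x ∈ Finset.univ.filter (fun x : I × (B × Δ) => x.2.1 ∈ W x.1), f x
      = ∑ s, ∑ b ∈ W s, ∑ d, f (s, (b, d)) := by
  rw [Finset.sum_filter, Fintype.sum_prod_type]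
  refine Finset.sum_congr rfl fun s _ => ?_
  rw [Fintype.sum_prod_type]
  dsimp only
  rw [Finset.sum_congr rfl fun b _ =>
    show (∑ y, if b ∈ W s then f (s, b, y) else 0) = if b ∈ W s then ∑ y, f (s, b, y) else 0 by
      by_cases hb : b ∈ W s <;> simp [hb]]
  rw [Finset.sum_ite_mem, Finset.univ_inter]

/-- Family `i` of a box-indexed family of vectors, flattened to the single index `B × Δ`. [folklore] -/
def flat (z : I → B → Δ → X → ℂ) (i : I) : B × Δ → X → ℂ := fun x => z i x.1 x.2

omit [Fintype X] [DecidableEq X] [Fintype I] [Fintype B] [DecidableEq B] [Fintype Δ] [DecidableEq Δ] in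
/-- Unfolding of `flat`. [folklore] -/
@[simp] theorem flat_apply (z : I → B → Δ → X → ℂ) (i : I) (x : B × Δ) : flat z i x = z i x.1 x.2 := rfl

/-- `p` MUTUALLY UNBIASED BOX FRAMES: for each family `i : I` (`#I = p`) an orthogonal family
`(z_{i,b,d})_{b : B, d : Δ}` (`#B = p²` boxes of `#Δ ≥ 1` vectors each) of common norm² `a > 0`, every vector
of one family having mass exactly `a²/p²` on every box of every OTHER family:
`Σ_{d′} ‖⟨z_{i,b,d}|z_{i′,b′,d′}⟩‖² = a²/p²` (`i ≠ i′`).  By Bessel every family is then an orthogonal basis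
of one and the same `p²·#Δ`-dimensional space.  For `#Δ = 1` these are `p` mutually unbiased bases
(`MUBFrames.toBoxFrames`). [folklore] [cite: NielsenChuang2010, Box 2.3 p. 87] -/
structure MUBBoxFrames (p : ℕ) (a : ℝ) (z : I → B → Δ → X → ℂ) : Prop where
  apos : 0 < a
  ppos : 0 < p
  cardI : Fintype.card I = p
  cardB : Fintype.card B = p ^ 2
  dpos : 0 < Fintype.card Δ
  orth : ∀ i b d b' d', star (z i b d) ⬝ᵥ z i b' d' = if b = b' ∧ d = d' then ((a : ℂ)) else 0
  mub : ∀ i i', i ≠ i' → ∀ b d b', ∑ d', ‖star (z i b d) ⬝ᵥ z i' b' d'‖ ^ 2 = a ^ 2 / (p : ℝ) ^ 2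

omit [DecidableEq X] in
/-- (AC)'s `q` mutually unbiased orthogonal frames of size `q²` are `q` mutually unbiased box frames with
one-element boxes. [folklore] -/
theorem MUBFrames.toBoxFrames {J : Type*} [Fintype J] [DecidableEq J] {q : ℕ} {a : ℝ} {z : I → J → X → ℂ}
    (hF : MUBFrames q a z) : MUBBoxFrames q a (fun i j (_ : Unit) => z i j) where
  apos := hF.apos
  ppos := hF.qpos
  cardI := hF.cardI
  cardB := hF.cardJ
  dpos := by simp
  orth i b d b' d' := by
    rw [hF.orth]
    by_cases h : b = b' <;> simp [h]
  mub i i' h b d b' := by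
    rw [Fintype.sum_unique, hF.mub i i' h, div_pow]

namespace MUBBoxFrames

variable {p : ℕ} {a : ℝ} {z : I → B → Δ → X → ℂ}

omit [DecidableEq X] in
/-- `re⟨z|z⟩ = a`. [folklore] -/
theorem re_self (hF : MUBBoxFrames p a z) (i : I) (b : B) (d : Δ) : (star (z i b d) ⬝ᵥ z i b d).re = a := by
  rw [hF.orth, if_pos ⟨rfl, rfl⟩, Complex.ofReal_re]

omit [DecidableEq X] in
/-- Frame vectors are non-zero. [folklore] -/
theorem ne_zero (hF : MUBBoxFrames p a z) (i : I) (b : B) (d : Δ) : z i b d ≠ 0 := by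
  intro h0
  have h := hF.re_self i b d
  rw [h0, star_zero, zero_dotProduct, Complex.zero_re] at h
  exact absurd h hF.apos.ne

omit [DecidableEq X] in
/-- Orthogonality of a flattened family. [folklore] -/
theorem orth_flat (hF : MUBBoxFrames p a z) (i : I) (x y : B × Δ) :
    star (flat z i x) ⬝ᵥ flat z i y = if x = y then ((a : ℂ)) else 0 := by
  simp only [flat_apply]
  rw [hF.orth]
  by_cases h : x = y
  · subst h; simp
  · rw [if_neg h, if_neg]
    exact fun hh => h (Prod.ext hh.1 hh.2)

omit [DecidableEq X] in
/-- **Bessel's equality** over a box frame: `Σ_{b,d} ‖⟨z_{i,b,d}|z_{i′,b′,d′}⟩‖² = a·⟨z|z⟩` (own family: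
one term `a²`; other family: `p²` boxes of mass `a²/p²`). [folklore] [cite: NielsenChuang2010, Box 2.3 p. 87] -/
theorem bessel (hF : MUBBoxFrames p a z) (i i' : I) (b' : B) (d' : Δ) :
    ∑ b, ∑ d, ‖star (z i b d) ⬝ᵥ z i' b' d'‖ ^ 2 = a * (star (z i' b' d') ⬝ᵥ z i' b' d').re := by
  rw [hF.re_self]
  by_cases h : i = i'
  · subst h
    rw [Finset.sum_eq_single b' (fun b _ hb => Finset.sum_eq_zero fun d _ => by
        rw [hF.orth, if_neg (fun hh => hb hh.1), norm_zero, zero_pow two_ne_zero])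
      (fun h => absurd (Finset.mem_univ _) h)]
    rw [Finset.sum_eq_single d' (fun d _ hd => by
        rw [hF.orth, if_neg (fun hh => hd hh.2), norm_zero, zero_pow two_ne_zero])
      (fun h => absurd (Finset.mem_univ _) h)]
    rw [hF.orth, if_pos ⟨rfl, rfl⟩, Complex.norm_real, Real.norm_of_nonneg hF.apos.le, sq]
  · have hb : ∀ b, ∑ d, ‖star (z i b d) ⬝ᵥ z i' b' d'‖ ^ 2 = a ^ 2 / (p : ℝ) ^ 2 := fun b => by
      calc ∑ d, ‖star (z i b d) ⬝ᵥ z i' b' d'‖ ^ 2 = ∑ d, ‖star (z i' b' d') ⬝ᵥ z i b d‖ ^ 2 :=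
            Finset.sum_congr rfl fun d _ => by rw [norm_star_dotProduct_comm]
        _ = a ^ 2 / (p : ℝ) ^ 2 := hF.mub i' i (Ne.symm h) b' d' b
    rw [Finset.sum_congr rfl fun b _ => hb b, Finset.sum_const, Finset.card_univ, hF.cardB, nsmul_eq_mul]
    have hp : (p : ℝ) ≠ 0 := by exact_mod_cast hF.ppos.ne'
    push_cast
    field_simp

omit [DecidableEq X] in
/-- Bessel's equality in flattened form. [folklore] -/
theorem bessel_flat (hF : MUBBoxFrames p a z) (i i' : I) (b' : B) (d' : Δ) :
    ∑ x : B × Δ, ‖star (flat z i x) ⬝ᵥ z i' b' d'‖ ^ 2 = a * (star (z i' b' d') ⬝ᵥ z i' b' d').re := by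
  rw [← hF.bessel i i' b' d', Fintype.sum_prod_type]
  rfl

omit [DecidableEq X] in
/-- Every vector of every family lies in the span of every family: `z_{i′,b′,d′} = P_i z_{i′,b′,d′}`.
[folklore] -/
theorem expand (hF : MUBBoxFrames p a z) (i i' : I) (b' : B) (d' : Δ) :
    z i' b' d' = frameProj (flat z i) a (z i' b' d') :=
  eq_frameProj_of_bessel (flat z i) hF.apos (hF.orth_flat i) _ (hF.bessel_flat i i' b' d')

omit [DecidableEq X] in
/-- **Trace invariance:** `Σ_{b,d} ⟨z_{i,b,d}|A|z_{i,b,d}⟩` does not depend on the family `i`. [folklore] -/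
theorem trace_eq (hF : MUBBoxFrames p a z) (A : Matrix X X ℂ) (i i' : I) :
    ∑ x : B × Δ, star (flat z i x) ⬝ᵥ (A *ᵥ flat z i x)
      = ∑ x : B × Δ, star (flat z i' x) ⬝ᵥ (A *ᵥ flat z i' x) := by
  have h := sum_star_frameProj_mulVec (flat z i) (flat z i') hF.apos (hF.orth_flat i)
    (fun x => hF.expand i' i x.1 x.2) A
  rw [← h]
  exact Finset.sum_congr rfl fun x _ => by rw [flat_apply, ← hF.expand i i' x.1 x.2]

variable {κ : Type*} [Fintype κ] [DecidableEq κ]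

/-- If some outcome is `ε`-almost certain on a frame vector then `ε ≥ 0`. [folklore] -/
theorem eps_nonneg (hF : MUBBoxFrames p a z) (E : POVM X κ) {ε : ℝ} {s : I} {b : B} {d : Δ} {k : κ}
    (hk : E.AlmostCertain ε (z s b d) k) : 0 ≤ ε := by
  have h1 := E.weight_re_le (z s b d) k
  unfold POVM.AlmostCertain at hk
  rw [hF.re_self] at hk h1
  nlinarith [hF.apos]

omit [DecidableEq X] in
/-- `ε(p² + 1) < 1` with `p ≥ 1` forces `ε < 1/2`. [folklore] -/
theorem eps_lt_half (hF : MUBBoxFrames p a z) {ε : ℝ} (hε : ε * ((p : ℝ) ^ 2 + 1) < 1) : ε < 1 / 2 := by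
  have hp : (1 : ℝ) ≤ p := by exact_mod_cast hF.ppos
  by_contra h
  push Not at h
  nlinarith [mul_nonneg (sub_nonneg.2 h) (by nlinarith : (0 : ℝ) ≤ (p : ℝ) ^ 2 - 1)]

/-- A frame vector whose almost-certain outcome is NOT `A` carries `A`-weight at most `εa`.
[cite: NielsenChuang2010, §2.2.6 p. 90] -/
theorem weight_re_le_of_not_ac (hF : MUBBoxFrames p a z) (E : POVM X κ) {ε : ℝ} {s : I} {b : B} {d : Δ}
    {A : κ} (hex : ∃ k, E.AlmostCertain ε (z s b d) k) (hn : ¬ E.AlmostCertain ε (z s b d) A) :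
    (E.weight (z s b d) A).re ≤ ε * a := by
  obtain ⟨k, hk⟩ := hex
  have hkA : k ≠ A := fun h => hn (h ▸ hk)
  have h2 := E.weight_re_add_weight_re_le (z s b d) hkA
  unfold POVM.AlmostCertain at hk
  rw [hF.re_self] at h2 hk
  linarith

/-- Any weight of a frame vector is at most `a`. [cite: NielsenChuang2010, §2.2.6 p. 90] -/
theorem weight_re_le_a (hF : MUBBoxFrames p a z) (E : POVM X κ) (s : I) (b : B) (d : Δ) (A : κ) :
    (E.weight (z s b d) A).re ≤ a := by
  have := E.weight_re_le (z s b d) A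
  rwa [hF.re_self] at this

/-- **Box constancy:** when the almost-certain outcome is constant on boxes (`hE`) and `ε < 1/2`, the
almost-certain outcome of one vector is almost certain on its whole box. [cite: NielsenChuang2010, §2.2.6 p. 90] -/
theorem box_ac (hF : MUBBoxFrames p a z) (E : POVM X κ) {ε : ℝ} (hε2 : ε < 1 / 2)
    (hE : ∀ i b, ∃ k, ∀ d, E.AlmostCertain ε (z i b d) k) {i : I} {b : B} {d : Δ} {A : κ}
    (h : E.AlmostCertain ε (z i b d) A) (d' : Δ) : E.AlmostCertain ε (z i b d') A := by
  obtain ⟨k, hk⟩ := hE i b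
  have hkA : k = A := E.almostCertain_unique hε2 (hF.ne_zero i b d) (hk d) h
  exact hkA ▸ hk d'

/-- **The frame trace from above, keeping the high boxes:** with `W` the set of `A`-high boxes of family `s`,
`Σ_{b,d} ⟨z_{s,b,d}|E_A|z_{s,b,d}⟩ ≤ Σ_{b ∈ W} Σ_d ⟨z_{s,b,d}|E_A|z_{s,b,d}⟩ + (p² − #W)·#Δ·εa`.
[cite: NielsenChuang2010, §2.2.6 p. 90] -/
theorem trace_le' (hF : MUBBoxFrames p a z) (E : POVM X κ) {ε : ℝ} {s : I} {A : κ} (hε2 : ε < 1 / 2)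
    (hE : ∀ i b, ∃ k, ∀ d, E.AlmostCertain ε (z i b d) k)
    (W : Finset B) (hW : ∀ b, b ∈ W ↔ ∀ d, E.AlmostCertain ε (z s b d) A) :
    ∑ b, ∑ d, (E.weight (z s b d) A).re
      ≤ ∑ b ∈ W, ∑ d, (E.weight (z s b d) A).re
        + ((p : ℝ) ^ 2 - W.card) * (Fintype.card Δ * (ε * a)) := by
  classical
  have hsplit := (Finset.sum_filter_add_sum_filter_not Finset.univ (fun b => b ∈ W)
    fun b => ∑ d, (E.weight (z s b d) A).re).symm
  have hf1 : Finset.univ.filter (fun b => b ∈ W) = W := by ext b; simp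
  have hcard2 : ((Finset.univ.filter fun b => ¬ b ∈ W).card : ℝ) = (p : ℝ) ^ 2 - W.card := by
    have h := Finset.card_filter_add_card_filter_not (s := Finset.univ) (fun b => b ∈ W)
    rw [hf1, Finset.card_univ, hF.cardB] at h
    have h' : ((W.card + (Finset.univ.filter fun b => ¬ b ∈ W).card : ℕ) : ℝ) = ((p ^ 2 : ℕ) : ℝ) := by
      exact_mod_cast h
    push_cast at h'
    linarith
  rw [hsplit, hf1]
  have h2 : ∑ b ∈ Finset.univ.filter (fun b => ¬ b ∈ W), ∑ d, (E.weight (z s b d) A).re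
      ≤ (Finset.univ.filter (fun b => ¬ b ∈ W)).card * (Fintype.card Δ * (ε * a)) := by
    have := Finset.sum_le_card_nsmul (Finset.univ.filter (fun b => ¬ b ∈ W))
      (fun b => ∑ d, (E.weight (z s b d) A).re) (Fintype.card Δ * (ε * a))
      (fun b hb => by
        have hnot : ∀ d, ¬ E.AlmostCertain ε (z s b d) A := fun d h =>
          (Finset.mem_filter.1 hb).2 ((hW b).2 fun d' => hF.box_ac E hε2 hE h d')
        have h := Finset.sum_le_card_nsmul Finset.univ (fun d => (E.weight (z s b d) A).re) (ε * a)
          (fun d _ => hF.weight_re_le_of_not_ac E ((hE s b).imp fun k hk => hk d) (hnot d))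
        rwa [nsmul_eq_mul, Finset.card_univ] at h)
    rwa [nsmul_eq_mul] at this
  rw [hcard2] at h2
  linarith

omit [DecidableEq κ] in
/-- The high boxes of a family weigh at least `#Δ(1 − ε)a` each:
`#W·#Δ·(1 − ε)a ≤ Σ_{b ∈ W} Σ_d ⟨z_{s,b,d}|E_A|z_{s,b,d}⟩`. [cite: NielsenChuang2010, §2.2.6 p. 90] -/
theorem card_mul_le_sum_high (hF : MUBBoxFrames p a z) (E : POVM X κ) {ε : ℝ} {s : I} {A : κ}
    (W : Finset B) (hW : ∀ b, b ∈ W ↔ ∀ d, E.AlmostCertain ε (z s b d) A) :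
    (W.card : ℝ) * (Fintype.card Δ * ((1 - ε) * a)) ≤ ∑ b ∈ W, ∑ d, (E.weight (z s b d) A).re := by
  have := Finset.card_nsmul_le_sum W (fun b => ∑ d, (E.weight (z s b d) A).re)
    (Fintype.card Δ * ((1 - ε) * a))
    (fun b hb => by
      have h := Finset.card_nsmul_le_sum Finset.univ (fun d => (E.weight (z s b d) A).re) ((1 - ε) * a)
        (fun d _ => by
          have h := (hW b).1 hb d
          unfold POVM.AlmostCertain at h
          rwa [hF.re_self] at h)
      rwa [nsmul_eq_mul, Finset.card_univ] at h)
  rwa [nsmul_eq_mul] at this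

/-- The high boxes of a family weigh at most `#Δ·a` each. [cite: NielsenChuang2010, §2.2.6 p. 90] -/
theorem sum_high_le (hF : MUBBoxFrames p a z) (E : POVM X κ) {s : I} {A : κ} (W : Finset B) :
    ∑ b ∈ W, ∑ d, (E.weight (z s b d) A).re ≤ (W.card : ℝ) * (Fintype.card Δ * a) := by
  have := Finset.sum_le_card_nsmul W (fun b => ∑ d, (E.weight (z s b d) A).re) (Fintype.card Δ * a)
    (fun b _ => by
      have h := Finset.sum_le_card_nsmul Finset.univ (fun d => (E.weight (z s b d) A).re) a
        (fun d _ => hF.weight_re_le_a E s b d A)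
      rwa [nsmul_eq_mul, Finset.card_univ] at h)
  rwa [nsmul_eq_mul] at this

omit [DecidableEq κ] in
/-- The frame trace of an effect is the same in every family (double-sum form). [folklore] -/
theorem trace_weight_eq (hF : MUBBoxFrames p a z) (E : POVM X κ) (A : κ) (s s' : I) :
    ∑ b, ∑ d, (E.weight (z s b d) A).re = ∑ b, ∑ d, (E.weight (z s' b d) A).re := by
  have h := hF.trace_eq (E.effect A) s s'
  rw [Fintype.sum_prod_type, Fintype.sum_prod_type] at h
  simp only [flat_apply] at h
  simp only [POVM.weight]
  have h' := congrArg Complex.re h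
  rw [Complex.re_sum, Complex.re_sum] at h'
  simp only [Complex.re_sum] at h'
  exact h'

omit [Fintype I] [DecidableEq B] [DecidableEq Δ] [DecidableEq κ] in
/-- The frame trace in flattened form equals the double sum. [folklore] -/
theorem trace_flat_eq (E : POVM X κ) (A : κ) (s : I) :
    ∑ x : B × Δ, (E.weight (flat z s x) A).re = ∑ b, ∑ d, (E.weight (z s b d) A).re := by
  rw [Fintype.sum_prod_type]
  rfl

/-- **Every family has an `A`-high box** as soon as one frame vector anywhere is `A`-high and
`ε(p² + 1) < 1`: otherwise the trace would be at most `p²·#Δ·εa < #Δ(1 − ε)a`. [folklore] -/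
theorem exists_high_box (hF : MUBBoxFrames p a z) (E : POVM X κ) {ε : ℝ} (hε : ε * ((p : ℝ) ^ 2 + 1) < 1)
    (hE : ∀ i b, ∃ k, ∀ d, E.AlmostCertain ε (z i b d) k) {A : κ} {i₀ : I} {b₀ : B} {d₀ : Δ}
    (hA : E.AlmostCertain ε (z i₀ b₀ d₀) A) (s : I) : ∃ b, ∀ d, E.AlmostCertain ε (z s b d) A := by
  classical
  by_contra hno
  push Not at hno
  have hε2 := hF.eps_lt_half hε
  have ha := hF.apos
  have hbox : ∀ d, E.AlmostCertain ε (z i₀ b₀ d) A := fun d => hF.box_ac E hε2 hE hA d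
  have h1 : (Fintype.card Δ : ℝ) * ((1 - ε) * a) ≤ ∑ b, ∑ d, (E.weight (z i₀ b d) A).re := by
    have hin : ∑ d, (E.weight (z i₀ b₀ d) A).re ≤ ∑ b, ∑ d, (E.weight (z i₀ b d) A).re :=
      Finset.single_le_sum (f := fun b => ∑ d, (E.weight (z i₀ b d) A).re)
        (fun b _ => Finset.sum_nonneg fun d _ => E.weight_re_nonneg _ _) (Finset.mem_univ b₀)
    have hlow : (Fintype.card Δ : ℝ) * ((1 - ε) * a) ≤ ∑ d, (E.weight (z i₀ b₀ d) A).re := by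
      have h := Finset.card_nsmul_le_sum Finset.univ (fun d => (E.weight (z i₀ b₀ d) A).re) ((1 - ε) * a)
        (fun d _ => by
          have h := hbox d
          unfold POVM.AlmostCertain at h
          rwa [hF.re_self] at h)
      rwa [nsmul_eq_mul, Finset.card_univ] at h
    exact hlow.trans hin
  rw [hF.trace_weight_eq E A i₀ s] at h1
  have h2 := hF.trace_le' E (s := s) (A := A) hε2 hE ∅
    (fun b => ⟨fun h => absurd h (Finset.notMem_empty b),
      fun hh => ((hno b).elim fun d hd => hd (hh d)).elim⟩)
  simp only [Finset.card_empty, Nat.cast_zero, sub_zero, Finset.sum_empty, zero_add] at h2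
  have hD : (1 : ℝ) ≤ Fintype.card Δ := by exact_mod_cast hF.dpos
  have h3 := h1.trans h2
  have h4 : (Fintype.card Δ * a) * (1 - ε) ≤ (Fintype.card Δ * a) * ((p : ℝ) ^ 2 * ε) := by
    nlinarith [h3]
  have h5 : 1 - ε ≤ (p : ℝ) ^ 2 * ε := le_of_mul_le_mul_left h4 (by positivity)
  nlinarith

/-- **All families have the same number of `A`-high boxes** (when `ε(p² + 1) < 1`): the frame trace is
family-independent and sandwiched between `#W_r·#Δ(1 − ε)a` and `#W_s·#Δ·a + (p² − #W_s)·#Δ·εa`.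
[folklore] -/
theorem card_high_le (hF : MUBBoxFrames p a z) (E : POVM X κ) {ε : ℝ} (hε : ε * ((p : ℝ) ^ 2 + 1) < 1)
    (hE : ∀ i b, ∃ k, ∀ d, E.AlmostCertain ε (z i b d) k) {A : κ} (r s : I) (Wr Ws : Finset B)
    (hWr : ∀ b, b ∈ Wr ↔ ∀ d, E.AlmostCertain ε (z r b d) A)
    (hWs : ∀ b, b ∈ Ws ↔ ∀ d, E.AlmostCertain ε (z s b d) A) : Wr.card ≤ Ws.card := by
  have ha := hF.apos
  have hε2 := hF.eps_lt_half hε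
  have hD : (1 : ℝ) ≤ Fintype.card Δ := by exact_mod_cast hF.dpos
  have h1 := hF.card_mul_le_sum_high E Wr hWr
  have h2 : ∑ b ∈ Wr, ∑ d, (E.weight (z r b d) A).re ≤ ∑ b, ∑ d, (E.weight (z r b d) A).re :=
    Finset.sum_le_sum_of_subset_of_nonneg (Finset.subset_univ _)
      fun b _ _ => Finset.sum_nonneg fun d _ => E.weight_re_nonneg _ _
  rw [hF.trace_weight_eq E A r s] at h2
  have h3 := hF.trace_le' E hε2 hE Ws hWs
  have h3' := hF.sum_high_le E (s := s) (A := A) Ws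
  have h4 : (((Wr.card : ℝ) - Ws.card) * (1 - ε)) * (Fintype.card Δ * a)
      ≤ ((p : ℝ) ^ 2 * ε) * (Fintype.card Δ * a) := by nlinarith
  have h5 : ((Wr.card : ℝ) - Ws.card) * (1 - ε) ≤ (p : ℝ) ^ 2 * ε :=
    le_of_mul_le_mul_right h4 (by positivity)
  have h1e : 0 < 1 - ε := by linarith
  have h6 : (Wr.card : ℝ) - Ws.card < 1 := by
    by_contra hge
    push Not at hge
    nlinarith
  have h7 : (Wr.card : ℝ) < Ws.card + 1 := by linarith
  have h8 : Wr.card < Ws.card + 1 := by exact_mod_cast h7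
  omega

omit [DecidableEq X] in
/-- **The Gram row of one vector against all high boxes** (`n` high boxes per family):
`Σ_{s′} Σ_{b′ ∈ W_{s′}} Σ_{d′} ‖⟨z_{s,b,d}|z_{s′,b′,d′}⟩‖² ≤ a² + (p − 1)·n·a²/p²` (own family at most `a²` by
Bessel, each other family exactly `n·a²/p²`). [folklore] -/
theorem gram_row_le (hF : MUBBoxFrames p a z) (s : I) (b : B) (d : Δ) (Wf : I → Finset B) {n : ℕ}
    (hcard : ∀ s', (Wf s').card = n) :
    ∑ s', ∑ b' ∈ Wf s', ∑ d', ‖star (z s b d) ⬝ᵥ z s' b' d'‖ ^ 2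
      ≤ a ^ 2 + ((p : ℝ) - 1) * n * (a ^ 2 / (p : ℝ) ^ 2) := by
  classical
  rw [← Finset.add_sum_erase _ _ (Finset.mem_univ s)]
  have h1 : ∑ b' ∈ Wf s, ∑ d', ‖star (z s b d) ⬝ᵥ z s b' d'‖ ^ 2 ≤ a ^ 2 := by
    calc ∑ b' ∈ Wf s, ∑ d', ‖star (z s b d) ⬝ᵥ z s b' d'‖ ^ 2
        ≤ ∑ b', ∑ d', ‖star (z s b d) ⬝ᵥ z s b' d'‖ ^ 2 :=
          Finset.sum_le_sum_of_subset_of_nonneg (Finset.subset_univ _)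
            fun _ _ _ => Finset.sum_nonneg fun _ _ => sq_nonneg _
      _ = ∑ b', ∑ d', ‖star (z s b' d') ⬝ᵥ z s b d‖ ^ 2 :=
          Finset.sum_congr rfl fun b' _ => Finset.sum_congr rfl fun d' _ => by
            rw [norm_star_dotProduct_comm]
      _ = a * (star (z s b d) ⬝ᵥ z s b d).re := hF.bessel s s b d
      _ = a ^ 2 := by rw [hF.re_self, sq]
  have h2 : ∀ s' ∈ Finset.univ.erase s,
      ∑ b' ∈ Wf s', ∑ d', ‖star (z s b d) ⬝ᵥ z s' b' d'‖ ^ 2 = n * (a ^ 2 / (p : ℝ) ^ 2) := by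
    intro s' hs'
    have hne : s ≠ s' := (Finset.ne_of_mem_erase hs').symm
    rw [Finset.sum_congr rfl fun b' _ => hF.mub s s' hne b d b', Finset.sum_const, hcard s', nsmul_eq_mul]
  rw [Finset.sum_congr rfl h2, Finset.sum_const, Finset.card_erase_of_mem (Finset.mem_univ s),
    Finset.card_univ, hF.cardI, nsmul_eq_mul, Nat.cast_sub hF.ppos, Nat.cast_one]
  linarith

set_option maxHeartbeats 400000 in
/-- **The key inequality for box frames — the multiplicity cancels.**  If `A` is almost certain somewhere,
`ε(p² + 1) < 1`, outcomes are box-constant, and the set `W` of `A`-high boxes of family `r` has `2·#W ≤ p²`,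
then with `n = #W ≥ 1`: `n p³ (1 − ε)² ≤ (p² + (p − 1)n)·(n(1 − ε) + (p² − n)ε)` — LITERALLY the inequality
of (AD) `MUBFrames.key_ineq` with `q = p`: the core inequality `𝔖² ≤ (𝒯/a)·G` of (AD) `sq_sum_weight_le`
for `u` = all vectors of all high boxes, with `𝔖 ≥ p·n·D(1 − ε)a`, `p𝒯 ≤ 𝔖 + p(p² − n)Dεa`,
`pG ≤ a²nD(p² + (p − 1)n)`, `D = #Δ`, after which `D` and `a` cancel.
[folklore] [cite: NielsenChuang2010, §2.2.6 p. 90, Box 2.3 p. 87] -/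
theorem key_ineq (hF : MUBBoxFrames p a z) (E : POVM X κ) {ε : ℝ} (hε : ε * ((p : ℝ) ^ 2 + 1) < 1)
    (hE : ∀ i b, ∃ k, ∀ d, E.AlmostCertain ε (z i b d) k) {A : κ} {i₀ : I} {b₀ : B} {d₀ : Δ}
    (hA : E.AlmostCertain ε (z i₀ b₀ d₀) A) (r : I) (W : Finset B)
    (hW : ∀ b, b ∈ W ↔ ∀ d, E.AlmostCertain ε (z r b d) A) (hhalf : 2 * W.card ≤ p ^ 2) :
    (W.card : ℝ) * (p : ℝ) ^ 3 * (1 - ε) ^ 2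
      ≤ ((p : ℝ) ^ 2 + ((p : ℝ) - 1) * W.card)
          * ((W.card : ℝ) * (1 - ε) + ((p : ℝ) ^ 2 - W.card) * ε) := by
  classical
  have ha := hF.apos
  have hε0 : 0 ≤ ε := hF.eps_nonneg E hA
  have hε2 := hF.eps_lt_half hε
  have hq1 : (1 : ℝ) ≤ p := by exact_mod_cast hF.ppos
  have hQ0 : (0 : ℝ) < p := by linarith
  have hD1 : (1 : ℝ) ≤ Fintype.card Δ := by exact_mod_cast hF.dpos
  have hε1 : ε < 1 := by linarith
  -- the high boxes of all families, all `W.card` many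
  set Wf : I → Finset B := fun s => Finset.univ.filter fun b => ∀ d, E.AlmostCertain ε (z s b d) A
    with hWfd
  have hWf : ∀ s b, b ∈ Wf s ↔ ∀ d, E.AlmostCertain ε (z s b d) A := fun s b => by simp [hWfd]
  have hcard : ∀ s, (Wf s).card = W.card := fun s =>
    le_antisymm (hF.card_high_le E hε hE s r (Wf s) W (hWf s) hW)
      (hF.card_high_le E hε hE r s W (Wf s) hW (hWf s))
  have h1 : 1 ≤ W.card := by
    obtain ⟨b, hb⟩ := hF.exists_high_box E hε hE hA r
    exact Finset.card_pos.2 ⟨b, (hW b).2 hb⟩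
  have hn1 : (1 : ℝ) ≤ W.card := by exact_mod_cast h1
  have hn2 : 2 * (W.card : ℝ) ≤ (p : ℝ) ^ 2 := by exact_mod_cast hhalf
  have hq2 : (2 : ℝ) ≤ p := by
    have h2q : 2 ≤ p := by nlinarith [hhalf, h1, Nat.zero_le p]
    exact_mod_cast h2q
  -- the set of all high vectors `(s, (b, d))`, `b ∈ W_s`, of size `p·#W·#Δ`
  set H : Finset (I × (B × Δ)) := Finset.univ.filter fun x : I × (B × Δ) => x.2.1 ∈ Wf x.1 with hHd
  have hHcard : (H.card : ℝ) = p * W.card * Fintype.card Δ := by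
    have : H.card = ∑ s : I, ∑ b ∈ Wf s, ∑ _d : Δ, 1 := by
      rw [Finset.card_eq_sum_ones, hHd, sum_highBox_eq Wf (fun _ => 1)]
    rw [this]
    simp only [Finset.sum_const, Finset.card_univ, smul_eq_mul, mul_one]
    rw [Finset.sum_congr rfl fun s _ => by rw [hcard s], Finset.sum_const, Finset.card_univ, hF.cardI,
      smul_eq_mul]
    push_cast
    ring
  -- the core inequality in the coordinates of frame `r`, with `u` = all high vectors
  have core := sq_sum_weight_le E A (flat z r) ha (hF.orth_flat r) (P := ↥H)
    (fun q => z q.1.1 q.1.2.1 q.1.2.2) (fun q => hF.expand r q.1.1 q.1.2.1 q.1.2.2)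
    (fun q => hF.re_self q.1.1 q.1.2.1 q.1.2.2)
  have e1 : ∑ q : ↥H, (E.weight (z q.1.1 q.1.2.1 q.1.2.2) A).re
      = ∑ x ∈ H, (E.weight (z x.1 x.2.1 x.2.2) A).re :=
    Finset.sum_coe_sort H (fun x => (E.weight (z x.1 x.2.1 x.2.2) A).re)
  have e2 : ∑ q : ↥H, ∑ q' : ↥H, ‖star (z q.1.1 q.1.2.1 q.1.2.2) ⬝ᵥ z q'.1.1 q'.1.2.1 q'.1.2.2‖ ^ 2
      = ∑ x ∈ H, ∑ x' ∈ H, ‖star (z x.1 x.2.1 x.2.2) ⬝ᵥ z x'.1 x'.2.1 x'.2.2‖ ^ 2 := by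
    rw [← Finset.sum_coe_sort H
      (fun x => ∑ x' ∈ H, ‖star (z x.1 x.2.1 x.2.2) ⬝ᵥ z x'.1 x'.2.1 x'.2.2‖ ^ 2)]
    exact Finset.sum_congr rfl fun q _ =>
      Finset.sum_coe_sort H (fun x' => ‖star (z q.1.1 q.1.2.1 q.1.2.2) ⬝ᵥ z x'.1 x'.2.1 x'.2.2‖ ^ 2)
  rw [e1, e2, trace_flat_eq] at core
  have eS : ∑ x ∈ H, (E.weight (z x.1 x.2.1 x.2.2) A).re
      = ∑ s, ∑ b ∈ Wf s, ∑ d, (E.weight (z s b d) A).re :=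
    sum_highBox_eq Wf (fun x => (E.weight (z x.1 x.2.1 x.2.2) A).re)
  -- (i) `𝔖 ≥ p·n·D·(1 − ε)a`
  have hS : (p : ℝ) * W.card * (Fintype.card Δ * ((1 - ε) * a))
      ≤ ∑ x ∈ H, (E.weight (z x.1 x.2.1 x.2.2) A).re := by
    rw [eS]
    have hs : ∀ s, (W.card : ℝ) * (Fintype.card Δ * ((1 - ε) * a))
        ≤ ∑ b ∈ Wf s, ∑ d, (E.weight (z s b d) A).re := fun s => by
      have h := hF.card_mul_le_sum_high E (Wf s) (hWf s)
      rwa [hcard s] at h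
    calc (p : ℝ) * W.card * (Fintype.card Δ * ((1 - ε) * a))
        = ∑ _s : I, (W.card : ℝ) * (Fintype.card Δ * ((1 - ε) * a)) := by
          rw [Finset.sum_const, Finset.card_univ, hF.cardI, nsmul_eq_mul]; ring
      _ ≤ _ := Finset.sum_le_sum fun s _ => hs s
  -- (ii) `p𝒯 ≤ 𝔖 + p(p² − n)Dεa`
  have hT : (p : ℝ) * ∑ b, ∑ d, (E.weight (z r b d) A).re
      ≤ ∑ x ∈ H, (E.weight (z x.1 x.2.1 x.2.2) A).re
        + p * (((p : ℝ) ^ 2 - W.card) * (Fintype.card Δ * (ε * a))) := by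
    rw [eS]
    have hs : ∀ s, ∑ b, ∑ d, (E.weight (z r b d) A).re
        ≤ ∑ b ∈ Wf s, ∑ d, (E.weight (z s b d) A).re
          + ((p : ℝ) ^ 2 - W.card) * (Fintype.card Δ * (ε * a)) := fun s => by
      have h := hF.trace_le' E hε2 hE (Wf s) (hWf s)
      rw [hcard s, ← hF.trace_weight_eq E A r s] at h
      exact h
    calc (p : ℝ) * ∑ b, ∑ d, (E.weight (z r b d) A).re
        = ∑ _s : I, ∑ b, ∑ d, (E.weight (z r b d) A).re := by
          rw [Finset.sum_const, Finset.card_univ, hF.cardI, nsmul_eq_mul]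
      _ ≤ ∑ s : I, (∑ b ∈ Wf s, ∑ d, (E.weight (z s b d) A).re
            + ((p : ℝ) ^ 2 - W.card) * (Fintype.card Δ * (ε * a))) :=
          Finset.sum_le_sum fun s _ => hs s
      _ = _ := by
          rw [Finset.sum_add_distrib, Finset.sum_const, Finset.card_univ, hF.cardI, nsmul_eq_mul]
  -- (iii) `G ≤ a²·n·D·(p² + (p − 1)n)/p`
  have hG : ∑ x ∈ H, ∑ x' ∈ H, ‖star (z x.1 x.2.1 x.2.2) ⬝ᵥ z x'.1 x'.2.1 x'.2.2‖ ^ 2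
      ≤ a ^ 2 * W.card * Fintype.card Δ * ((p : ℝ) ^ 2 + ((p : ℝ) - 1) * W.card) / p := by
    have row : ∀ x ∈ H, ∑ x' ∈ H, ‖star (z x.1 x.2.1 x.2.2) ⬝ᵥ z x'.1 x'.2.1 x'.2.2‖ ^ 2
        ≤ a ^ 2 + ((p : ℝ) - 1) * W.card * (a ^ 2 / (p : ℝ) ^ 2) := fun x _ => by
      rw [sum_highBox_eq Wf (fun x' => ‖star (z x.1 x.2.1 x.2.2) ⬝ᵥ z x'.1 x'.2.1 x'.2.2‖ ^ 2)]
      exact hF.gram_row_le x.1 x.2.1 x.2.2 Wf hcard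
    calc ∑ x ∈ H, ∑ x' ∈ H, ‖star (z x.1 x.2.1 x.2.2) ⬝ᵥ z x'.1 x'.2.1 x'.2.2‖ ^ 2
        ≤ ∑ _x ∈ H, (a ^ 2 + ((p : ℝ) - 1) * W.card * (a ^ 2 / (p : ℝ) ^ 2)) := Finset.sum_le_sum row
      _ = H.card * (a ^ 2 + ((p : ℝ) - 1) * W.card * (a ^ 2 / (p : ℝ) ^ 2)) := by
          rw [Finset.sum_const, nsmul_eq_mul]
      _ = a ^ 2 * W.card * Fintype.card Δ * ((p : ℝ) ^ 2 + ((p : ℝ) - 1) * W.card) / p := by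
          rw [hHcard]; field_simp
  have hG0 : 0 ≤ ∑ x ∈ H, ∑ x' ∈ H, ‖star (z x.1 x.2.1 x.2.2) ⬝ᵥ z x'.1 x'.2.1 x'.2.2‖ ^ 2 :=
    Finset.sum_nonneg fun _ _ => Finset.sum_nonneg fun _ _ => sq_nonneg _
  -- (iv) elimination of `𝔖, 𝒯, G`; the multiplicity `D` and the norm `a` cancel at the end
  generalize ∑ x ∈ H, (E.weight (z x.1 x.2.1 x.2.2) A).re = S at core hS hT
  generalize ∑ b, ∑ d, (E.weight (z r b d) A).re = T at core hT
  generalize ∑ x ∈ H, ∑ x' ∈ H, ‖star (z x.1 x.2.1 x.2.2) ⬝ᵥ z x'.1 x'.2.1 x'.2.2‖ ^ 2 = G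
    at core hG hG0
  generalize (W.card : ℝ) = n at hn1 hn2 hS hT hG ⊢
  generalize (Fintype.card Δ : ℝ) = D at hD1 hS hT hG
  have hD0 : 0 < D := by linarith
  have hSpos : 0 ≤ S :=
    le_trans (mul_nonneg (mul_nonneg hQ0.le (by linarith))
      (mul_nonneg hD0.le (mul_nonneg (by linarith) ha.le))) hS
  have core1 : a * S ^ 2 ≤ T * G := by
    have h := mul_le_mul_of_nonneg_left core ha.le
    have e : a * (T / a * G) = T * G := by field_simp
    linarith
  have step2 : (p : ℝ) * a * S ^ 2 ≤ (S + p * (((p : ℝ) ^ 2 - n) * (D * (ε * a)))) * G := by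
    have h₁ : (p : ℝ) * (a * S ^ 2) ≤ p * (T * G) := mul_le_mul_of_nonneg_left core1 hQ0.le
    have h₂ : ((p : ℝ) * T) * G ≤ (S + p * (((p : ℝ) ^ 2 - n) * (D * (ε * a)))) * G :=
      mul_le_mul_of_nonneg_right hT hG0
    linarith
  have hSεpos : 0 ≤ S + p * (((p : ℝ) ^ 2 - n) * (D * (ε * a))) :=
    add_nonneg hSpos (mul_nonneg hQ0.le (mul_nonneg (by linarith)
      (mul_nonneg hD0.le (mul_nonneg hε0 ha.le))))
  have step3 : (p : ℝ) * a * S ^ 2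
      ≤ (S + p * (((p : ℝ) ^ 2 - n) * (D * (ε * a))))
          * (a ^ 2 * n * D * ((p : ℝ) ^ 2 + ((p : ℝ) - 1) * n) / p) :=
    step2.trans (mul_le_mul_of_nonneg_left hG hSεpos)
  have step4 : (p : ℝ) ^ 2 * S ^ 2
      ≤ (S + p * (((p : ℝ) ^ 2 - n) * (D * (ε * a))))
          * (a * n * D * ((p : ℝ) ^ 2 + ((p : ℝ) - 1) * n)) := by
    have h := mul_le_mul_of_nonneg_left step3 hQ0.le
    have e : (p : ℝ) * ((S + p * (((p : ℝ) ^ 2 - n) * (D * (ε * a))))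
          * (a ^ 2 * n * D * ((p : ℝ) ^ 2 + ((p : ℝ) - 1) * n) / p))
        = a * ((S + p * (((p : ℝ) ^ 2 - n) * (D * (ε * a))))
            * (a * n * D * ((p : ℝ) ^ 2 + ((p : ℝ) - 1) * n))) := by
      field_simp
    rw [e] at h
    have h' : a * ((p : ℝ) ^ 2 * S ^ 2)
        ≤ a * ((S + p * (((p : ℝ) ^ 2 - n) * (D * (ε * a))))
            * (a * n * D * ((p : ℝ) ^ 2 + ((p : ℝ) - 1) * n))) := by
      linarith
    exact le_of_mul_le_mul_left h' ha
  -- monotone substitution `S ↦ S₀ = p n D (1 − ε) a ≤ S` in `p²S² − (a n D L)S`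
  have cL : a * n * D * ((p : ℝ) ^ 2 + ((p : ℝ) - 1) * n)
      ≤ 2 * (p : ℝ) ^ 2 * (p * n * (D * ((1 - ε) * a))) := by
    have hL : (p : ℝ) ^ 2 + ((p : ℝ) - 1) * n ≤ 2 * (p : ℝ) ^ 3 * (1 - ε) := by
      have hεq : ε * (p : ℝ) ^ 2 < 1 := by nlinarith [mul_nonneg hε0 (sq_nonneg (p : ℝ))]
      have hεq3 : (p : ℝ) * (ε * (p : ℝ) ^ 2) < p * 1 := mul_lt_mul_of_pos_left hεq hQ0
      nlinarith [mul_nonneg (by linarith : (0 : ℝ) ≤ (p : ℝ) - 1) (by linarith : (0 : ℝ) ≤ (p : ℝ) ^ 2 - 2 * n),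
        mul_nonneg (mul_nonneg hQ0.le (by linarith : (0 : ℝ) ≤ 3 * (p : ℝ) - 4))
          (by linarith : (0 : ℝ) ≤ (p : ℝ) + 1)]
    have := mul_le_mul_of_nonneg_left hL
      (mul_nonneg (mul_nonneg ha.le (by linarith : (0 : ℝ) ≤ n)) hD0.le)
    exact this.trans_eq (by ring)
  have mono : (p : ℝ) ^ 2 * (p * n * (D * ((1 - ε) * a))) ^ 2
        - (a * n * D * ((p : ℝ) ^ 2 + ((p : ℝ) - 1) * n)) * (p * n * (D * ((1 - ε) * a)))
      ≤ (p : ℝ) ^ 2 * S ^ 2 - (a * n * D * ((p : ℝ) ^ 2 + ((p : ℝ) - 1) * n)) * S := by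
    have hd : 0 ≤ S - p * n * (D * ((1 - ε) * a)) := sub_nonneg.2 hS
    have hm : 0 ≤ (p : ℝ) ^ 2 * (S + p * n * (D * ((1 - ε) * a)))
        - a * n * D * ((p : ℝ) ^ 2 + ((p : ℝ) - 1) * n) := by
      linarith [mul_nonneg (sq_nonneg (p : ℝ)) hd]
    linarith [mul_nonneg hd hm]
  have fin : (p : ℝ) ^ 2 * (p * n * (D * ((1 - ε) * a))) ^ 2
        - (a * n * D * ((p : ℝ) ^ 2 + ((p : ℝ) - 1) * n)) * (p * n * (D * ((1 - ε) * a)))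
      ≤ (p * (((p : ℝ) ^ 2 - n) * (D * (ε * a)))) * (a * n * D * ((p : ℝ) ^ 2 + ((p : ℝ) - 1) * n)) := by
    linarith
  have hpos : 0 < (p : ℝ) * a ^ 2 * n * D ^ 2 :=
    mul_pos (mul_pos (mul_pos hQ0 (pow_pos ha 2)) (by linarith)) (pow_pos hD0 2)
  have fin' : (p : ℝ) * a ^ 2 * n * D ^ 2 * (n * (p : ℝ) ^ 3 * (1 - ε) ^ 2)
      ≤ (p : ℝ) * a ^ 2 * n * D ^ 2
          * (((p : ℝ) ^ 2 + ((p : ℝ) - 1) * n) * (n * (1 - ε) + ((p : ℝ) ^ 2 - n) * ε)) := by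
    linarith
  exact le_of_mul_le_mul_left fin' hpos

/-- **More than half of the boxes of every family are `A`-high** (`p ≥ 3`): an occurring outcome `A` —
almost certain on one frame vector anywhere, with `ε(p² + 1) < 1` and box-constant outcomes — is almost
certain on MORE THAN HALF of the boxes of every family. [folklore]
[cite: NielsenChuang2010, §2.2.6 p. 90, Box 2.3 p. 87] -/
theorem half_lt_card₃ (hF : MUBBoxFrames p a z) (hp : 3 ≤ p) (E : POVM X κ) {ε : ℝ}
    (hε : ε * ((p : ℝ) ^ 2 + 1) < 1) (hE : ∀ i b, ∃ k, ∀ d, E.AlmostCertain ε (z i b d) k) {A : κ}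
    {i₀ : I} {b₀ : B} {d₀ : Δ} (hA : E.AlmostCertain ε (z i₀ b₀ d₀) A) (r : I)
    (W : Finset B) (hW : ∀ b, b ∈ W ↔ ∀ d, E.AlmostCertain ε (z r b d) A) :
    (p : ℝ) ^ 2 < 2 * W.card := by
  classical
  by_contra hle
  push Not at hle
  have hhalf : 2 * W.card ≤ p ^ 2 := by exact_mod_cast hle
  have h1 : 1 ≤ W.card := by
    obtain ⟨b, hb⟩ := hF.exists_high_box E hε hE hA r
    exact Finset.card_pos.2 ⟨b, (hW b).2 hb⟩
  have key := hF.key_ineq E hε hE hA r W hW hhalf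
  exact MUBFrames.key_contra (by exact_mod_cast hp) (by exact_mod_cast h1) hle hε key

/-- **Constancy below `1/(p² + 1)` for box frames, `p ≥ 3`.**  For `p ≥ 3` mutually unbiased box frames and a
general measurement that is `ε`-almost sure on every frame vector with `ε·(p² + 1) < 1` AND whose
almost-certain outcome is constant on every box, ALL frame vectors have one and the same almost-certain
outcome (two different outcomes would each be high on more than half of the boxes of one family).  For
one-element boxes this is (AD) `MUBFrames.sameOutcome₃`; the point of the box version is that the
threshold `1/(p² + 1)` does not depend on the box size — the coarse step of the composite analysis of Chen's
Step 8 (module docstring).  HONEST FRAMING: linear algebra recorded for the analysis of a WITHDRAWN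
algorithm; by itself it changes nothing about Step 8 and is not summit progress.
[folklore] [cite: NielsenChuang2010, §2.2.6 p. 90, Box 2.3 p. 87] -/
theorem sameOutcome₃ (hF : MUBBoxFrames p a z) (hp : 3 ≤ p) (E : POVM X κ) {ε : ℝ}
    (hε : ε * ((p : ℝ) ^ 2 + 1) < 1) (hE : ∀ i b, ∃ k, ∀ d, E.AlmostCertain ε (z i b d) k)
    {i i' : I} {b b' : B} {d d' : Δ} {k k' : κ} (hk : E.AlmostCertain ε (z i b d) k)
    (hk' : E.AlmostCertain ε (z i' b' d') k') : k = k' := by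
  classical
  by_contra hkk
  have hε2 := hF.eps_lt_half hε
  obtain ⟨d₁⟩ : Nonempty Δ := Fintype.card_pos_iff.1 hF.dpos
  set W : Finset B := Finset.univ.filter fun b => ∀ d, E.AlmostCertain ε (z i b d) k with hWd
  set W' : Finset B := Finset.univ.filter fun b => ∀ d, E.AlmostCertain ε (z i b d) k' with hW'd
  have hW : ∀ b, b ∈ W ↔ ∀ d, E.AlmostCertain ε (z i b d) k := fun b => by simp [hWd]
  have hW' : ∀ b, b ∈ W' ↔ ∀ d, E.AlmostCertain ε (z i b d) k' := fun b => by simp [hW'd]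
  have h1 := hF.half_lt_card₃ hp E hε hE hk i W hW
  have h2 := hF.half_lt_card₃ hp E hε hE hk' i W' hW'
  have hdisj : Disjoint W W' := by
    rw [Finset.disjoint_left]
    intro b hb hb'
    exact hkk (E.almostCertain_unique hε2 (hF.ne_zero i b d₁) ((hW b).1 hb d₁) ((hW' b).1 hb' d₁))
  have hcard : W.card + W'.card ≤ p ^ 2 := by
    rw [← Finset.card_union_of_disjoint hdisj, ← hF.cardB, ← Finset.card_univ]
    exact Finset.card_le_univ _
  have : ((W.card + W'.card : ℕ) : ℝ) ≤ ((p ^ 2 : ℕ) : ℝ) := by exact_mod_cast hcard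
  push_cast at this
  linarith

end MUBBoxFrames

end BOX

end Literature.Computability.Cryptography.Chen2024
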